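import Summits.QuantumAdvantage.QuantumAdvantage.Theorems.SoloInformedValueLiftCore
import Literature.Computability.Complexity.GuardedBallStages
import Literature.Computability.Complexity.PRelHierarchy
import Literature.Computability.Complexity.FPStringBricks
import Literature.Computability.Complexity.PlumbingBricks
import Literature.Computability.Complexity.ListFoldBricks
import Literature.Computability.Complexity.StringEquality
import Literature.Computability.Complexity.LengthCompare
import Literature.Computability.Complexity.Promise
import HarnessLib

/-!
# Value-determined lifts, part 2: the affine-count families and unique witnesses

Solo programme `solo-QuantumAdvantage-informed`, theorem N1, part 2 of 3. We build ONE explicit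
uniform oracle-free Clifford+`T` family `affFamily hW` PER WITNESS CHECKER `W ∈ P` (any language; the
pair `⟨X, d⟩ ∈ W` reads "`X` is a witness for `d`" — e.g. `W = CircEval.EvalLang`, circuit `d` accepts
input `X`), whose acceptance probabilities realise, exactly, an affine menu of dyadic values controlled by
the input. An instance is `⟨u, ⟨c, ⟨g, ⟨f, d⟩⟩⟩⟩` (`boolPair` nesting; `v = |u|` is the witness length,
`c` a little-endian numeral, `g`, `f` two flags — active iff equal to `[1]` — and `d` the checked object),
the coins are `y ∈ {0,1}^{|x|}` and the `P`-predicate `affRel W` accepts `⟨x, y⟩` iff, writing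
`y = b₁ b₂ …`,
`(b₁ ∧ ¬ val(y[1..v+1]) < val c) ∨ (¬b₁ ∧ b₂ ∧ g = [1]) ∨ (¬b₁ ∧ ¬b₂ ∧ f = [1] ∧ ⟨y[2..v+1], d⟩ ∉ W)`.
Hence (`acceptProbOn_affFamily`)

  `p(⟨u,c,g,f,d⟩) = ( (2^{v+1} - min(val c, 2^{v+1})) + [g = 1]·2^v + [f = 1]·(2^v - #W(d)) ) / 2^{v+2}`,

so with `g` on the values `(3·2^v - c')/2^{v+2}`, `c' = 0 … 2^{v+1}`, sweep `[1/4, 3/4]` in steps of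
`2^{-(v+2)}`, and switching `g` off and `f` on subtracts exactly `#W(d)/2^{v+2}`, `#W(d)` the number of
witnesses of length `v`. Part 3 runs a bisection over a value-determined lift of this family's threshold
problem and reads off whether `#W(d) ∈ {0, 1}` is `0` or `1`: the promise problem `uniqueSAT W` defined here
(YES = exactly one witness, NO = none; for an `NP`-complete checker the target of Valiant–Vazirani's
randomised reduction from SAT, cf. `Literature.Computability.Complexity.valiant_vazirani`).

Everything here is kernel-checked down to the machine level: `affRel W ∈ P` is an `FP`-brick program
(`affInd`, bricks of `BrickAlgebra`/`PlumbingBricks`/`FPStringBricks`/`StringEquality` and the deciding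
machine of `W` as the brick `Oracle.ofLanguage W ∈ FP`),
the family is the tree's coin family over it (`exists_family_acceptProbOn_eq_uniformProb`, part 1), and
the probability is counted coin by coin (`uniformProb_succ_split`, `uniformProb_take_of_le`,
`uniformProb_bitsToNat_ge`).

References: Bernstein–Vazirani 1997, Thm. 8.3; Arora–Barak 2009, §7.1, Def. 1.13, §17.2.1;
Valiant–Vazirani 1986 (unique SAT).
-/

namespace Summit.QuantumAdvantage.QuantumAdvantage.Theorems

open _root_.Computability Literature.Computability.Complexity Literature.Computability.Complexity.Classes
  Literature.Computability.Cryptography Literature.Computability.QuantumComplexity Brick Plumb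

/-! ### Instances and the accepting predicate (semantics) -/

/-- The instance `⟨u, ⟨c, ⟨g, ⟨f, d⟩⟩⟩⟩` of the affine-count family. [folklore] -/
def affInst (u c g f d : List Bool) : List Bool := boolPair u (boolPair c (boolPair g (boolPair f d)))

/-- Length of an instance: `2|u| + 2|c| + 2|g| + 2|f| + |d| + 8 ≥ |u| + 2`. [folklore] -/
theorem length_affInst (u c g f d : List Bool) :
    (affInst u c g f d).length = 2 * u.length + 2 + (2 * c.length + 2 + (2 * g.length + 2 + (2 * f.length + 2 + d.length))) := by
  simp [affInst]

/-- **The accepting predicate on the coins `y`** of the instance `(u, c, g, f, d)` (`v = |u|`):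
`(b₁ ∧ ¬ val(y[1..v+1]) < val c) ∨ (¬b₁ ∧ b₂ ∧ g = [1]) ∨ (¬b₁ ∧ ¬b₂ ∧ f = [1] ∧ C_d(y[2..v+1]) = 0)`,
`b₁ b₂` the first two coins. [folklore] -/
noncomputable def affSem (W : Language Bool) (u c g f d y : List Bool) : Bool :=
  (decide (y.take 1 = [true]) && !decide (bitsToNat ((y.drop 1).take (u.length + 1)) < bitsToNat c)) ||
    ((!decide (y.take 1 = [true]) && (decide ((y.drop 1).take 1 = [true]) && decide (g = [true]))) ||
      (!decide (y.take 1 = [true]) && (!decide ((y.drop 1).take 1 = [true]) &&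
        (decide (f = [true]) && !W.boolIndicator (boolPair ((y.drop 2).take u.length) d)))))

/-- First coin `1`: the comparison branch. [folklore] -/
@[simp] theorem affSem_true_cons (W : Language Bool) (u c g f d r : List Bool) :
    affSem W u c g f d (true :: r) = !decide (bitsToNat (r.take (u.length + 1)) < bitsToNat c) := by
  simp [affSem]

/-- Coins `0 1 …`: the full branch, active iff `g = [1]`. [folklore] -/
@[simp] theorem affSem_false_true_cons (W : Language Bool) (u c g f d r : List Bool) :
    affSem W u c g f d (false :: true :: r) = decide (g = [true]) := by
  simp [affSem]

/-- Coins `0 0 …`: the witness branch, active iff `f = [1]`, accepting the NON-witnesses.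
[folklore] -/
@[simp] theorem affSem_false_false_cons (W : Language Bool) (u c g f d r : List Bool) :
    affSem W u c g f d (false :: false :: r) =
      (decide (f = [true]) && !W.boolIndicator (boolPair (r.take u.length) d)) := by
  simp [affSem]

/-- The predicate on a raw string `z`, read as `⟨⟨u, ⟨c, ⟨g, ⟨f, d⟩⟩⟩⟩, y⟩` with the total parser
`boolUnpair` (junk components on malformed input). [folklore] -/
noncomputable def affBit (W : Language Bool) (z : List Bool) : Bool :=
  affSem W (boolUnpair (boolUnpair z).1).1 (boolUnpair (boolUnpair (boolUnpair z).1).2).1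
    (boolUnpair (boolUnpair (boolUnpair (boolUnpair z).1).2).2).1
    (boolUnpair (boolUnpair (boolUnpair (boolUnpair (boolUnpair z).1).2).2).2).1
    (boolUnpair (boolUnpair (boolUnpair (boolUnpair (boolUnpair z).1).2).2).2).2 (boolUnpair z).2

/-- **The `P`-predicate of the family**: `affRel W = {z | affBit W z = 1}`. [folklore] -/
def affRel (W : Language Bool) : Language Bool := {z | affBit W z = true}

/-- `affBit` on a well-formed pair. [folklore] -/
@[simp] theorem affBit_boolPair (W : Language Bool) (u c g f d y : List Bool) :
    affBit W (boolPair (affInst u c g f d) y) = affSem W u c g f d y := by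
  simp [affBit, affInst]

/-- Membership of a well-formed pair in `affRel W`. [folklore] -/
theorem boolPair_mem_affRel (W : Language Bool) (u c g f d y : List Bool) :
    boolPair (affInst u c g f d) y ∈ affRel W ↔ affSem W u c g f d y = true := by
  change affBit W (boolPair (affInst u c g f d) y) = true ↔ _
  rw [affBit_boolPair]

/-! ### The predicate is in `P`: an `FP`-brick program -/

/-- Projection `z ↦ u`. [folklore] -/
def prU : List Bool → List Bool := fstP ∘ fstP
/-- Projection `z ↦ c`. [folklore] -/
def prC : List Bool → List Bool := fstP ∘ sndP ∘ fstP
/-- Projection `z ↦ g`. [folklore] -/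
def prG : List Bool → List Bool := fstP ∘ sndP ∘ sndP ∘ fstP
/-- Projection `z ↦ f`. [folklore] -/
def prF : List Bool → List Bool := fstP ∘ sndP ∘ sndP ∘ sndP ∘ fstP
/-- Projection `z ↦ d`. [folklore] -/
def prD : List Bool → List Bool := sndP ∘ sndP ∘ sndP ∘ sndP ∘ fstP

/-- Test "first coin is `1`". [folklore] -/
noncomputable def bit1T : List Bool → List Bool := eqPairFn ∘ pairFn (take1Fn ∘ sndP) (fun _ => [true])
/-- Test "second coin is `1`". [folklore] -/
noncomputable def bit2T : List Bool → List Bool :=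
  eqPairFn ∘ pairFn (bitAtFn ∘ pairFn (fun _ => [true]) sndP) (fun _ => [true])
/-- The compared window `y[1..v+1]`. [folklore] -/
noncomputable def winF : List Bool → List Bool :=
  takeFn ∘ pairFn (List.cons true ∘ prU) (dropFn ∘ pairFn (fun _ => [true]) sndP)
/-- The candidate witness `y[2..v+1]`. [folklore] -/
noncomputable def cinF : List Bool → List Bool :=
  takeFn ∘ pairFn prU (dropFn ∘ pairFn (fun _ => [true, true]) sndP)
/-- Test "`¬ val(window) < val c`". [folklore] -/
noncomputable def geT : List Bool → List Bool := notFn (ltFn ∘ pairFn winF prC)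
/-- Test "`g = [1]`". [folklore] -/
noncomputable def gT : List Bool → List Bool := eqPairFn ∘ pairFn prG (fun _ => [true])
/-- Test "`f = [1]`". [folklore] -/
noncomputable def fT : List Bool → List Bool := eqPairFn ∘ pairFn prF (fun _ => [true])
/-- Test "`⟨y[2..v+1], d⟩ ∉ W`" (the deciding machine of `W` as a brick). [folklore] -/
noncomputable def rejT (W : Language Bool) : List Bool → List Bool :=
  notFn (Oracle.ofLanguage W ∘ pairFn cinF prD)

/-- **The indicator program** of `affRel W`. [cite: AroraBarak2009, §1.3] -/
noncomputable def affInd (W : Language Bool) : List Bool → List Bool :=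
  orFn (andFn bit1T geT)
    (orFn (andFn (notFn bit1T) (andFn bit2T gT))
      (andFn (notFn bit1T) (andFn (notFn bit2T) (andFn fT (rejT W)))))

/-- `affInd W ∈ FP` for `W ∈ P`. [cite: AroraBarak2009, §1.3, Def. 1.13] -/
theorem affInd_mem_FP {W : Language Bool} (hW : W ∈ P) : affInd W ∈ FP := by
  have hU : prU ∈ FP := comp_mem_FP fstP_mem_FP fstP_mem_FP
  have hC : prC ∈ FP := comp_mem_FP fstP_mem_FP (comp_mem_FP sndP_mem_FP fstP_mem_FP)
  have hG : prG ∈ FP := comp_mem_FP fstP_mem_FP (comp_mem_FP sndP_mem_FP (comp_mem_FP sndP_mem_FP fstP_mem_FP))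
  have hF : prF ∈ FP :=
    comp_mem_FP fstP_mem_FP (comp_mem_FP sndP_mem_FP (comp_mem_FP sndP_mem_FP (comp_mem_FP sndP_mem_FP fstP_mem_FP)))
  have hD : prD ∈ FP :=
    comp_mem_FP sndP_mem_FP (comp_mem_FP sndP_mem_FP (comp_mem_FP sndP_mem_FP (comp_mem_FP sndP_mem_FP fstP_mem_FP)))
  have h1 : bit1T ∈ FP :=
    comp_mem_FP eqPairFn_mem_FP (pairFn_mem_FP (comp_mem_FP take1Fn_mem_FP sndP_mem_FP) (const_mem_FP _))
  have h2 : bit2T ∈ FP :=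
    comp_mem_FP eqPairFn_mem_FP (pairFn_mem_FP
      (comp_mem_FP bitAtFn_mem_FP (pairFn_mem_FP (const_mem_FP _) sndP_mem_FP)) (const_mem_FP _))
  have hwin : winF ∈ FP :=
    comp_mem_FP takeFn_mem_FP (pairFn_mem_FP (comp_mem_FP (cons_mem_FP true) hU)
      (comp_mem_FP dropFn_mem_FP (pairFn_mem_FP (const_mem_FP _) sndP_mem_FP)))
  have hcin : cinF ∈ FP :=
    comp_mem_FP takeFn_mem_FP (pairFn_mem_FP hU
      (comp_mem_FP dropFn_mem_FP (pairFn_mem_FP (const_mem_FP _) sndP_mem_FP)))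
  have hge : geT ∈ FP := notFn_mem_FP (comp_mem_FP ltFn_mem_FP (pairFn_mem_FP hwin hC))
  have hg : gT ∈ FP := comp_mem_FP eqPairFn_mem_FP (pairFn_mem_FP hG (const_mem_FP _))
  have hf : fT ∈ FP := comp_mem_FP eqPairFn_mem_FP (pairFn_mem_FP hF (const_mem_FP _))
  have hev : rejT W ∈ FP :=
    notFn_mem_FP (comp_mem_FP (GuardedBall.ofLanguage_mem_FP_of_mem_P hW) (pairFn_mem_FP hcin hD))
  exact orFn_mem_FP (andFn_mem_FP h1 hge)
    (orFn_mem_FP (andFn_mem_FP (notFn_mem_FP h1) (andFn_mem_FP h2 hg))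
      (andFn_mem_FP (notFn_mem_FP h1) (andFn_mem_FP (notFn_mem_FP h2) (andFn_mem_FP hf hev))))

/-- **The indicator program computes `affBit`** on every string. [folklore] -/
theorem affInd_apply (W : Language Bool) (z : List Bool) : affInd W z = [affBit W z] := by
  -- values of the leaves
  have e1 : bit1T z = [decide ((boolUnpair z).2.take 1 = [true])] := by
    simp only [bit1T, Function.comp_apply, pairFn_apply, eqPairFn_boolPair, take1Fn, sndP]
  have e2 : bit2T z = [decide (((boolUnpair z).2.drop 1).take 1 = [true])] := by
    simp only [bit2T, Function.comp_apply, pairFn_apply, eqPairFn_boolPair, bitAtFn_boolPair, sndP,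
      List.length_cons, List.length_nil, zero_add]
  have ege : geT z = [!decide (bitsToNat (((boolUnpair z).2.drop 1).take ((boolUnpair (boolUnpair z).1).1.length + 1)) <
      bitsToNat (boolUnpair (boolUnpair (boolUnpair z).1).2).1)] := by
    have : (ltFn ∘ pairFn winF prC) z = [decide (bitsToNat (((boolUnpair z).2.drop 1).take
        ((boolUnpair (boolUnpair z).1).1.length + 1)) < bitsToNat (boolUnpair (boolUnpair (boolUnpair z).1).2).1)] := by
      simp only [Function.comp_apply, pairFn_apply, ltFn_boolPair, winF, prU, prC, fstP, sndP, takeFn_boolPair,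
        dropFn_boolPair, List.length_cons, List.length_nil, zero_add]
    rw [geT, notFn_apply this]
  have eg : gT z = [decide ((boolUnpair (boolUnpair (boolUnpair (boolUnpair z).1).2).2).1 = [true])] := by
    simp only [gT, prG, Function.comp_apply, pairFn_apply, eqPairFn_boolPair, fstP, sndP]
  have ef : fT z = [decide ((boolUnpair (boolUnpair (boolUnpair (boolUnpair (boolUnpair z).1).2).2).2).1 = [true])] := by
    simp only [fT, prF, Function.comp_apply, pairFn_apply, eqPairFn_boolPair, fstP, sndP]
  have eev : rejT W z = [!W.boolIndicator (boolPair (((boolUnpair z).2.drop 2).take (boolUnpair (boolUnpair z).1).1.length)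
      (boolUnpair (boolUnpair (boolUnpair (boolUnpair (boolUnpair z).1).2).2).2).2)] := by
    have : (Oracle.ofLanguage W ∘ pairFn cinF prD) z = [W.boolIndicator (boolPair (((boolUnpair z).2.drop 2).take
        (boolUnpair (boolUnpair z).1).1.length) (boolUnpair (boolUnpair (boolUnpair (boolUnpair (boolUnpair z).1).2).2).2).2)] := by
      simp only [cinF, prU, prD, Function.comp_apply, pairFn_apply, PRelSigma.ofLanguage_eq_singleton, fstP, sndP,
        takeFn_boolPair, dropFn_boolPair, List.length_cons, List.length_nil, zero_add, Nat.reduceAdd]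
    rw [rejT, notFn_apply this]
  have en1 := notFn_apply e1
  have en2 := notFn_apply e2
  rw [affInd, orFn_apply (andFn_apply e1 ege) (orFn_apply (andFn_apply en1 (andFn_apply e2 eg))
    (andFn_apply en1 (andFn_apply en2 (andFn_apply ef eev))))]
  rfl

/-- **`affRel W ∈ P`** for `W ∈ P`. [cite: AroraBarak2009, Def. 1.13] -/
theorem affRel_mem_P {W : Language Bool} (hW : W ∈ P) : affRel W ∈ P :=
  mem_P_of_mem_FP (affInd_mem_FP hW) (affRel W) fun w => by
    constructor
    · intro hw; rw [affInd_apply, show affBit W w = true from hw]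
    · intro hw
      rw [affInd_apply]
      have : affBit W w ≠ true := hw
      rw [eq_false_of_ne_true this]

/-! ### Counting: the exact acceptance probability -/

/-- The number of NON-witnesses `X ∈ {0,1}^{|u|}` of `d` (`⟨X, d⟩ ∉ W`). [folklore] -/
noncomputable def unsatCount (W : Language Bool) (u d : List Bool) : ℕ :=
  open scoped Classical in
  (Finset.univ.filter fun X : List.Vector Bool u.length => W.boolIndicator (boolPair X.toList d) = false).card

/-- The number of witnesses `X ∈ {0,1}^{|u|}` of `d` (`⟨X, d⟩ ∈ W`). [folklore] -/
noncomputable def satCount (W : Language Bool) (u d : List Bool) : ℕ :=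
  open scoped Classical in
  (Finset.univ.filter fun X : List.Vector Bool u.length => W.boolIndicator (boolPair X.toList d) = true).card

/-- `#W + #¬W = 2^v`. [folklore] -/
theorem satCount_add_unsatCount (W : Language Bool) (u d : List Bool) :
    satCount W u d + unsatCount W u d = 2 ^ u.length := by
  classical
  unfold satCount unsatCount
  have h := Finset.card_filter_add_card_filter_not (s := (Finset.univ : Finset (List.Vector Bool u.length)))
    (fun X => W.boolIndicator (boolPair X.toList d) = true)
  rw [Finset.card_univ, card_vector, Fintype.card_bool] at h
  rw [← h]
  congr 2
  exact Finset.filter_congr fun X _ => by simp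

/-- `satCount` counts the witnesses of length `|u|`. [folklore] -/
theorem satCount_eq_card (W : Language Bool) (u d : List Bool) :
    open scoped Classical in
    satCount W u d = (Finset.univ.filter fun X : List.Vector Bool u.length => boolPair X.toList d ∈ W).card := by
  classical
  unfold satCount
  exact congrArg Finset.card (Finset.filter_congr fun X _ => (Set.mem_iff_boolIndicator _ _).symm)

/-- The coin probability of the witness branch is `#¬W / 2^v`. [folklore] -/
theorem uniformProb_unsat (W : Language Bool) (u d : List Bool) :
    uniformProb u.length {X | W.boolIndicator (boolPair X d) = false} = (unsatCount W u d : ℝ) / 2 ^ u.length := by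
  classical
  unfold uniformProb unsatCount
  simp only [Set.mem_setOf_eq]

/-- **The exact acceptance count of `affRel W`** on `m ≥ v + 2` coins:
`Pr_y[⟨x, y⟩ ∈ affRel W] = ((2^{v+1} - min(val c, 2^{v+1})) + [g = 1] 2^v + [f = 1] #¬W(d)) / 2^{v+2}`.
[cite: AroraBarak2009, §7.1] -/
theorem uniformProb_affRel (W : Language Bool) (u c g f d : List Bool) {m : ℕ} (hm : u.length + 2 ≤ m) :
    uniformProb m {y | boolPair (affInst u c g f d) y ∈ affRel W} =
      (((2 ^ (u.length + 1) - min (bitsToNat c) (2 ^ (u.length + 1)) : ℕ) : ℝ) +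
          (if g = [true] then (2 : ℝ) ^ u.length else 0) +
          (if f = [true] then (unsatCount W u d : ℝ) else 0)) / 2 ^ (u.length + 2) := by
  obtain ⟨n, rfl⟩ : ∃ n, m = n + 1 + 1 := ⟨m - 2, by omega⟩
  have hn : u.length ≤ n := by omega
  set v := u.length with hv
  -- branch `1 r`: the comparison, a prefix event of length `v + 1`
  have hA : uniformProb (n + 1) {r | true :: r ∈ {y | boolPair (affInst u c g f d) y ∈ affRel W}} =
      (((2 ^ (v + 1) - min (bitsToNat c) (2 ^ (v + 1)) : ℕ) : ℝ)) / 2 ^ (v + 1) := by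
    rw [← uniformProb_bitsToNat_ge (v + 1) (bitsToNat c), ← uniformProb_take_of_le (show v + 1 ≤ n + 1 by omega)]
    refine SumcheckMA.uniformProb_congr_len fun r _ => ?_
    simp only [Set.mem_setOf_eq, boolPair_mem_affRel, affSem_true_cons, Bool.not_eq_true', decide_eq_false_iff_not,
      hv]
  -- branch `0 1 r'`: everything, iff `g = [1]`
  have hB : uniformProb n {r | true :: r ∈ {r | false :: r ∈ {y | boolPair (affInst u c g f d) y ∈ affRel W}}} =
      if g = [true] then 1 else 0 := by
    split_ifs with hg
    · rw [← uniformProb_univ n]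
      exact SumcheckMA.uniformProb_congr_len fun r _ => by simp [boolPair_mem_affRel, hg]
    · rw [← uniformProb_empty n]
      exact SumcheckMA.uniformProb_congr_len fun r _ => by simp [boolPair_mem_affRel, hg]
  -- branch `0 0 r'`: the witness branch, iff `f = [1]`, a prefix event of length `v`
  have hC : uniformProb n {r | false :: r ∈ {r | false :: r ∈ {y | boolPair (affInst u c g f d) y ∈ affRel W}}} =
      if f = [true] then (unsatCount W u d : ℝ) / 2 ^ v else 0 := by
    split_ifs with hf
    · rw [hv, ← uniformProb_unsat W u d, ← uniformProb_take_of_le (show u.length ≤ n by omega)]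
      refine SumcheckMA.uniformProb_congr_len fun r _ => ?_
      simp [boolPair_mem_affRel, hf]
    · rw [← uniformProb_empty n]
      exact SumcheckMA.uniformProb_congr_len fun r _ => by simp [boolPair_mem_affRel, hf]
  rw [uniformProb_succ_split, hA, uniformProb_succ_split n, hB, hC]
  have h2 : (2 : ℝ) ^ (v + 2) = 2 ^ v * 4 := by rw [pow_add]; norm_num
  have h1 : (2 : ℝ) ^ (v + 1) = 2 ^ v * 2 := by rw [pow_succ]
  have hpos : (0 : ℝ) < 2 ^ v := by positivity
  split_ifs <;> (rw [h2, h1]; field_simp; ring)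

/-! ### The family -/

/-- **The affine-count family of the checker `W ∈ P`**: the tree's coin family over `affRel W` with
`|x|` coins. (A definite description: Hadamards on the coin wires followed by the reversible simulation of
the `P`-machine of `affRel W`; chosen here by `Classical.choose` from part 1's existence theorem.)
[cite: BernsteinVazirani1997, Thm. 8.3 (proof)] -/
noncomputable def affFamily {W : Language Bool} (hW : W ∈ P) : QCircuitFamily cliffordT :=
  Classical.choose (exists_family_acceptProbOn_eq_uniformProb (affRel_mem_P hW) Polynomial.X)

/-- `affFamily hW` is oracle-free. [cite: BernsteinVazirani1997, Thm. 8.3 (proof)] -/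
theorem affFamily_isOracleFree {W : Language Bool} (hW : W ∈ P) : (affFamily hW).IsOracleFree :=
  (Classical.choose_spec (exists_family_acceptProbOn_eq_uniformProb (affRel_mem_P hW) Polynomial.X)).1

/-- `affFamily hW` is polynomial-time uniform. [cite: BernsteinVazirani1997, Thm. 8.3 (proof)] -/
theorem affFamily_isUniform {W : Language Bool} (hW : W ∈ P) : (affFamily hW).IsUniform :=
  (Classical.choose_spec (exists_family_acceptProbOn_eq_uniformProb (affRel_mem_P hW) Polynomial.X)).2.1

/-- The acceptance probability of `affFamily hW` is the coin probability of `affRel W` with `|x|` coins.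
[cite: BernsteinVazirani1997, Thm. 8.3 (proof)] -/
theorem acceptProbOn_affFamily {W : Language Bool} (hW : W ∈ P) (x : List Bool) :
    (affFamily hW).acceptProbOn 0 x = uniformProb x.length {y | boolPair x y ∈ affRel W} := by
  have h := (Classical.choose_spec (exists_family_acceptProbOn_eq_uniformProb (affRel_mem_P hW) Polynomial.X)).2.2 x
  rwa [Polynomial.eval_X] at h

/-- **The value menu.** On the instance `⟨u, ⟨c, ⟨g, ⟨f, d⟩⟩⟩⟩` (`v = |u|`) the family accepts with
probability exactly `((2^{v+1} - min(val c, 2^{v+1})) + [g = 1]·2^v + [f = 1]·#¬W_v(d)) / 2^{v+2}`.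
[cite: BernsteinVazirani1997, Thm. 8.3 (proof)] [cite: AroraBarak2009, §7.1] -/
theorem acceptProbOn_affFamily_affInst {W : Language Bool} (hW : W ∈ P) (u c g f d : List Bool) :
    (affFamily hW).acceptProbOn 0 (affInst u c g f d) =
      (((2 ^ (u.length + 1) - min (bitsToNat c) (2 ^ (u.length + 1)) : ℕ) : ℝ) +
          (if g = [true] then (2 : ℝ) ^ u.length else 0) +
          (if f = [true] then (unsatCount W u d : ℝ) else 0)) / 2 ^ (u.length + 2) := by
  rw [acceptProbOn_affFamily]
  exact uniformProb_affRel W u c g f d (by rw [length_affInst]; omega)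

/-- **The comparison instances** (`g` on, `f` off) with a numeral `c`, `val c ≤ 2^{v+1}`:
value `(3·2^v - val c) / 2^{v+2}`. [folklore] -/
theorem acceptProbOn_affFamily_cmp {W : Language Bool} (hW : W ∈ P) (u c d : List Bool)
    (hc : bitsToNat c ≤ 2 ^ (u.length + 1)) :
    (affFamily hW).acceptProbOn 0 (affInst u c [true] [] d) = ((3 * 2 ^ u.length - bitsToNat c : ℕ) : ℝ) / 2 ^ (u.length + 2) := by
  rw [acceptProbOn_affFamily_affInst, min_eq_left hc, if_pos rfl, if_neg (by decide)]
  congr 1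
  have h3 : bitsToNat c ≤ 3 * 2 ^ u.length := hc.trans (by rw [pow_succ]; omega)
  rw [Nat.cast_sub hc, Nat.cast_sub h3]
  push_cast
  ring

/-- **The probe instances** (`g` off, `f` on) with a numeral `c`, `val c ≤ 2^{v+1}`:
value `(3·2^v - val c - #W_v(d)) / 2^{v+2}` — the comparison value at `c` lowered by exactly
`#W(d) / 2^{v+2}`. [folklore] -/
theorem acceptProbOn_affFamily_probe {W : Language Bool} (hW : W ∈ P) (u c d : List Bool)
    (hc : bitsToNat c ≤ 2 ^ (u.length + 1)) :
    (affFamily hW).acceptProbOn 0 (affInst u c [] [true] d) =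
      ((3 * 2 ^ u.length - bitsToNat c : ℕ) - satCount W u d : ℝ) / 2 ^ (u.length + 2) := by
  rw [acceptProbOn_affFamily_affInst, min_eq_left hc, if_neg (by decide), if_pos rfl]
  congr 1
  have h3 : bitsToNat c ≤ 3 * 2 ^ u.length := hc.trans (by rw [pow_succ]; omega)
  have hsu := satCount_add_unsatCount W u d
  have hun : (unsatCount W u d : ℝ) = 2 ^ u.length - satCount W u d := by
    have : ((satCount W u d + unsatCount W u d : ℕ) : ℝ) = (2 : ℝ) ^ u.length := by rw [hsu]; push_cast; ring
    push_cast at this; linarith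
  rw [Nat.cast_sub hc, Nat.cast_sub h3, hun]
  push_cast
  ring

/-! ### Unique witnesses -/

/-- **Unique-`W`** as a promise problem on instances `⟨u, d⟩` (witness length `|u|`): YES = `d` has
exactly one witness of length `|u|`, NO = none. (For the checker of circuit-SAT this is unique-SAT, the
target of the Valiant–Vazirani isolation; `PromiseUP`-hard for an `NP`-complete checker.) [folklore] -/
def uniqueSAT (W : Language Bool) : PromiseProblem :=
  ⟨{x | ∃ u d, x = boolPair u d ∧ satCount W u d = 1}, {x | ∃ u d, x = boolPair u d ∧ satCount W u d = 0}⟩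

/-- The two sides of `uniqueSAT W` are disjoint. [folklore] -/
theorem uniqueSAT_disjoint (W : Language Bool) : (uniqueSAT W).Disjoint := by
  rw [PromiseProblem.Disjoint, disjoint_iff_inf_le]
  rintro x ⟨⟨u, d, rfl, h1⟩, ⟨u', d', he, h0⟩⟩
  exfalso
  have := boolPair_injective (a₁ := (u, d)) (a₂ := (u', d')) (by simpa using he)
  simp only [Prod.mk.injEq] at this
  obtain ⟨rfl, rfl⟩ := this
  omega

end Summit.QuantumAdvantage.QuantumAdvantage.Theorems
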